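import Summits.CriticalPhenomena.PercolationContinuityZ3.Theorems.PercNearOneGluingNoHeavyLowerTailKNGoodGainLemmas
import HarnessLib

/-!
# The sixth cone row `ε ≤ γ + δ` for three relays
# (`NoHeavyLowerTail` cell, stmt-CriticalPhenomena-4575; prover `prim-hp-2`, goodness line, gen 15)

Support file (`--supports stmt-CriticalPhenomena-4575`).  No definitions, no named facts, no sorries.
With relays labelled `s₁ ≤ s₂ ≤ s₃` (`s_a = μ(a ↔ b)`), `s_{pq} = μ_{w[s(p,q)↦1]}(p ↔ b)`, `t_c = μ_{w[s(p,q)↦1]}(c ↔ b)` (`c` the bystander) and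
`γ = s₁₃ − t₂, δ = s₂₃ − t₁, ε = s₁₂ − t₃`, the inequality `ε ≤ γ + δ`, i.e.
`t₁ + t₂ + s₁₂ ≤ t₃ + s₁₃ + s₂₃`, holds whenever `s₁ ≤ s₃` and `s₂ ≤ s₃` (MEMO-gen15 §2b).  Together with order, Kozma–Nitzan Lemma 3(ii) (`γ, δ ≥ 0`)
and the gain lemmas (`δ ≥ α`, `ε ≥ −β`, `KNGoodGain`) this is the cone `𝒞₆` of the |A| = 3 goodness certificates.
Proof: pull the six glued probabilities back to `w` (`tieLiftTwo_real_update_one`, `KNGoodGain.preimage_insert_openConn_*`), after which the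
inequality is `μ(1b,3↮b) + μ(2b,1↮b) + 2μ(E) ≤ 2μ(3b,1↮b) + μ(3b,2↮b)` with `E = {1↔2, 3b, 1↮b}`, which follows from `s₂ ≤ s₃` and Lemma 3(ii)
`μ(1b, 1↮2) ≤ μ(3b, 1↮2)` (`KozmaNitzan2024_lemma3_ii_notConn`).

* `KNGoodGain.sixth_row` — the statement above for distinct `a₁ a₂ a₃`.
[cite: KozmaNitzan2024, Lemma 3(ii) (pp. 6–7), Lemma 5 (p. 13)]
-/

noncomputable section

namespace Summit.CriticalPhenomena.PercolationContinuityZ3.Theorems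

open MeasureTheory Set Literature.Probability.LatticeModels Literature.Probability.Percolation
open scoped Classical BigOperators

variable {n : ℕ}

namespace KNGoodGain

open ChampionStability

/-- Opening `s(p,q)`: if `c ↔ p` and `q ↔ b` (or `c ↔ q` and `p ↔ b`) beforehand then `c ↔ b` afterwards. [folklore] -/
theorem mem_preimage_insert_openConn_of (ω : BondConfig (Fin n)) {p q : Fin n} (hpq : p ≠ q) (c b : Fin n)
    (h : ((openGraph ω).Reachable c p ∧ (openGraph ω).Reachable q b) ∨ ((openGraph ω).Reachable c q ∧ (openGraph ω).Reachable p b)) :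
    ω ∈ (fun ω : BondConfig (Fin n) => insert s(p, q) ω) ⁻¹' (openConn c b : Set (BondConfig (Fin n))) := by
  simp only [mem_preimage, knThm2_mem_openConn]
  rw [reachable_insert_iff ω hpq]
  right
  rcases h with ⟨hcp, hqb⟩ | ⟨hcq, hpb⟩
  · exact ⟨⟨p, by simp, hcp⟩, ⟨q, by simp, hqb⟩⟩
  · exact ⟨⟨q, by simp, hcq⟩, ⟨p, by simp, hpb⟩⟩

/-- **The sixth cone row `ε ≤ γ + δ`.**  For distinct relays `a₁, a₂, a₃` with `μ(a₁ b) ≤ μ(a₃ b)` and `μ(a₂ b) ≤ μ(a₃ b)`: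
`μ_{w[s(a₂,a₃)↦1]}(a₁ b) + μ_{w[s(a₁,a₃)↦1]}(a₂ b) + μ_{w[s(a₁,a₂)↦1]}(a₁ b) ≤ μ_{w[s(a₁,a₂)↦1]}(a₃ b) + μ_{w[s(a₁,a₃)↦1]}(a₁ b) + μ_{w[s(a₂,a₃)↦1]}(a₂ b)`,
i.e. `t₁ + t₂ + s₁₂ ≤ t₃ + s₁₃ + s₂₃`. [cite: KozmaNitzan2024, Lemma 3(ii) (pp. 6–7)] -/
theorem sixth_row (w : Sym2 (Fin n) → unitInterval) (a₁ a₂ a₃ b : Fin n) (h12 : a₁ ≠ a₂) (h13 : a₁ ≠ a₃) (h23 : a₂ ≠ a₃)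
    (hle13 : (prodBernoulli w).real (openConn a₁ b) ≤ (prodBernoulli w).real (openConn a₃ b))
    (hle23 : (prodBernoulli w).real (openConn a₂ b) ≤ (prodBernoulli w).real (openConn a₃ b)) :
    (prodBernoulli (Function.update w s(a₂, a₃) 1)).real (openConn a₁ b) +
        (prodBernoulli (Function.update w s(a₁, a₃) 1)).real (openConn a₂ b) +
        (prodBernoulli (Function.update w s(a₁, a₂) 1)).real (openConn a₁ b) ≤
      (prodBernoulli (Function.update w s(a₁, a₂) 1)).real (openConn a₃ b) +
        (prodBernoulli (Function.update w s(a₁, a₃) 1)).real (openConn a₁ b) +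
        (prodBernoulli (Function.update w s(a₂, a₃) 1)).real (openConn a₂ b) := by
  haveI : ∀ u : Sym2 (Fin n) → unitInterval, IsProbabilityMeasure (prodBernoulli u) := fun u => inferInstance
  set μ := prodBernoulli w with hμ
  -- events in `w`
  set C1 : Set (BondConfig (Fin n)) := openConn a₁ b with hC1
  set C2 : Set (BondConfig (Fin n)) := openConn a₂ b with hC2
  set C3 : Set (BondConfig (Fin n)) := openConn a₃ b with hC3
  set R12 : Set (BondConfig (Fin n)) := openConn a₁ a₂ with hR12
  set E : Set (BondConfig (Fin n)) := R12 ∩ C3 ∩ C1ᶜ with hE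
  set F₁ : Set (BondConfig (Fin n)) := openConn a₁ a₃ ∩ C2 ∩ C1ᶜ with hF₁
  set F₂ : Set (BondConfig (Fin n)) := openConn a₂ a₃ ∩ C1 ∩ C2ᶜ with hF₂
  have hmeas : ∀ S : Set (BondConfig (Fin n)), MeasurableSet S := fun S => MeasurableSet.of_discrete
  have mem : ∀ (ω : BondConfig (Fin n)) (x y : Fin n), ω ∈ (openConn x y : Set (BondConfig (Fin n))) ↔ (openGraph ω).Reachable x y :=
    fun ω x y => Iff.rfl
  -- (i) t₁ ≤ μ C1 + μ E + μ F₁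
  have ht1 : (prodBernoulli (Function.update w s(a₂, a₃) 1)).real (openConn a₁ b) ≤ μ.real C1 + μ.real E + μ.real F₁ := by
    rw [tieLiftTwo_real_update_one w s(a₂, a₃) (openConn a₁ b)]
    have hsub := preimage_insert_openConn_bystander_subset (n := n) h23 a₁ b
    have hsub' : (fun ω : BondConfig (Fin n) => insert s(a₂, a₃) ω) ⁻¹' (openConn a₁ b : Set (BondConfig (Fin n))) ⊆ C1 ∪ (E ∪ F₁) := by
      intro ω hω
      rcases hsub hω with h | ⟨⟨h3b, h2b⟩, h12r⟩ | ⟨⟨h2b, h31⟩, h3b⟩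
      · exact Or.inl h
      · refine Or.inr (Or.inl ⟨⟨h12r, h3b⟩, fun h1b => h2b ?_⟩)
        exact (show (openGraph ω).Reachable a₁ a₂ from h12r).symm.trans h1b
      · refine Or.inr (Or.inr ⟨⟨(show (openGraph ω).Reachable a₃ a₁ from h31).symm, h2b⟩, fun h1b => h3b ?_⟩)
        exact (show (openGraph ω).Reachable a₃ a₁ from h31).trans h1b
    calc μ.real _ ≤ μ.real (C1 ∪ (E ∪ F₁)) := measureReal_mono hsub'
      _ ≤ μ.real C1 + μ.real (E ∪ F₁) := measureReal_union_le _ _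
      _ ≤ μ.real C1 + (μ.real E + μ.real F₁) := by have := measureReal_union_le (μ := μ) E F₁; linarith
      _ = μ.real C1 + μ.real E + μ.real F₁ := by ring
  -- (ii) t₂ ≤ μ C2 + μ E + μ F₂
  have ht2 : (prodBernoulli (Function.update w s(a₁, a₃) 1)).real (openConn a₂ b) ≤ μ.real C2 + μ.real E + μ.real F₂ := by
    rw [tieLiftTwo_real_update_one w s(a₁, a₃) (openConn a₂ b)]
    have hsub := preimage_insert_openConn_bystander_subset (n := n) h13 a₂ b
    have hsub' : (fun ω : BondConfig (Fin n) => insert s(a₁, a₃) ω) ⁻¹' (openConn a₂ b : Set (BondConfig (Fin n))) ⊆ C2 ∪ (E ∪ F₂) := by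
      intro ω hω
      rcases hsub hω with h | ⟨⟨h3b, h1b⟩, h21⟩ | ⟨⟨h1b, h32⟩, h3b⟩
      · exact Or.inl h
      · refine Or.inr (Or.inl ⟨⟨(show (openGraph ω).Reachable a₂ a₁ from h21).symm, h3b⟩, h1b⟩)
      · refine Or.inr (Or.inr ⟨⟨(show (openGraph ω).Reachable a₃ a₂ from h32).symm, h1b⟩, fun h2b => h3b ?_⟩)
        exact (show (openGraph ω).Reachable a₃ a₂ from h32).trans h2b
    calc μ.real _ ≤ μ.real (C2 ∪ (E ∪ F₂)) := measureReal_mono hsub'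
      _ ≤ μ.real C2 + μ.real (E ∪ F₂) := measureReal_union_le _ _
      _ ≤ μ.real C2 + (μ.real E + μ.real F₂) := by have := measureReal_union_le (μ := μ) E F₂; linarith
      _ = μ.real C2 + μ.real E + μ.real F₂ := by ring
  -- glued self-probabilities: μ_{w[s(p,q)↦1]}(p b) = μ(Cp) + μ(Cq ∩ Cpᶜ), and by symmetry for q
  have hself : ∀ (p q : Fin n), p ≠ q →
      (prodBernoulli (Function.update w s(p, q) 1)).real (openConn p b) =
        μ.real (openConn p b) + μ.real (openConn q b ∩ (openConn p b : Set (BondConfig (Fin n)))ᶜ) := by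
    intro p q hpq
    rw [tieLiftTwo_real_update_one w s(p, q) (openConn p b), preimage_insert_openConn_self hpq b]
    rw [← measureReal_union (μ := μ) (s₁ := openConn p b)
      (s₂ := openConn q b ∩ (openConn p b : Set (BondConfig (Fin n)))ᶜ) ?_ (hmeas _)]
    · congr 1
      ext ω
      simp only [mem_union, mem_inter_iff, mem_compl_iff]
      tauto
    · exact disjoint_left.mpr fun ω h1 h2 => h2.2 h1
  have hs12 : (prodBernoulli (Function.update w s(a₁, a₂) 1)).real (openConn a₁ b) = μ.real C1 + μ.real (C2 ∩ C1ᶜ) := hself a₁ a₂ h12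
  have hs13 : (prodBernoulli (Function.update w s(a₁, a₃) 1)).real (openConn a₁ b) = μ.real C1 + μ.real (C3 ∩ C1ᶜ) := hself a₁ a₃ h13
  have hs23 : (prodBernoulli (Function.update w s(a₂, a₃) 1)).real (openConn a₂ b) = μ.real C2 + μ.real (C3 ∩ C2ᶜ) := hself a₂ a₃ h23
  -- (iv) t₃ ≥ μ C3 + μ F₁ + μ F₂
  have ht3 : μ.real C3 + μ.real F₁ + μ.real F₂ ≤ (prodBernoulli (Function.update w s(a₁, a₂) 1)).real (openConn a₃ b) := by
    rw [tieLiftTwo_real_update_one w s(a₁, a₂) (openConn a₃ b)]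
    have hd1 : Disjoint C3 F₁ := disjoint_left.mpr fun ω h3b hF => hF.2 ((show (openGraph ω).Reachable a₁ a₃ from hF.1.1).trans h3b)
    have hd2 : Disjoint (C3 ∪ F₁) F₂ := by
      refine disjoint_left.mpr fun ω h hF => ?_
      rcases h with h3b | hF1
      · exact hF.2 ((show (openGraph ω).Reachable a₂ a₃ from hF.1.1).trans h3b)
      · exact hF.2 hF1.1.2
    have hsub : C3 ∪ F₁ ∪ F₂ ⊆ (fun ω : BondConfig (Fin n) => insert s(a₁, a₂) ω) ⁻¹' (openConn a₃ b : Set (BondConfig (Fin n))) := by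
      intro ω hω
      rcases hω with (h3b | hF1) | hF2
      · simp only [mem_preimage, knThm2_mem_openConn]
        rw [reachable_insert_iff ω h12]
        exact Or.inl h3b
      · exact mem_preimage_insert_openConn_of ω h12 a₃ b
          (Or.inl ⟨(show (openGraph ω).Reachable a₁ a₃ from hF1.1.1).symm, hF1.1.2⟩)
      · exact mem_preimage_insert_openConn_of ω h12 a₃ b
          (Or.inr ⟨(show (openGraph ω).Reachable a₂ a₃ from hF2.1.1).symm, hF2.1.2⟩)
    have hu1 : μ.real (C3 ∪ F₁) = μ.real C3 + μ.real F₁ := measureReal_union hd1 (hmeas _)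
    have hu2 : μ.real (C3 ∪ F₁ ∪ F₂) = μ.real (C3 ∪ F₁) + μ.real F₂ := measureReal_union hd2 (hmeas _)
    have := measureReal_mono (μ := μ) hsub
    linarith
  -- (vi) the core inequality: μ(C1∩C3ᶜ) + μ(C2∩C1ᶜ) + 2μ(E) ≤ 2μ(C3∩C1ᶜ) + μ(C3∩C2ᶜ)
  have split : ∀ S T : Set (BondConfig (Fin n)), μ.real S = μ.real (S ∩ T) + μ.real (S ∩ Tᶜ) := by
    intro S T
    have := measureReal_inter_add_sdiff (μ := μ) (s := S) (t := T) (hmeas T)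
    rw [Set.sdiff_eq] at this
    linarith
  -- from s₂ ≤ s₃ : μ(C2 ∩ C3ᶜ) ≤ μ(C3 ∩ C2ᶜ)
  have hrow23 : μ.real (C2 ∩ C3ᶜ) ≤ μ.real (C3 ∩ C2ᶜ) := by
    have e2 := split C2 C3
    have e3 := split C3 C2
    have hc : C2 ∩ C3 = C3 ∩ C2 := inter_comm _ _
    rw [hc] at e2
    linarith
  -- Lemma 3(ii): μ(C1 ∩ {1↮2}) ≤ μ(C3 ∩ {1↮2}); in the form μ(C1 ∩ R12ᶜ ∩ C3ᶜ) ≤ μ(C3 ∩ R12ᶜ ∩ C1ᶜ)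
  have hrow13 : μ.real (C1 ∩ R12ᶜ ∩ C3ᶜ) ≤ μ.real (C3 ∩ R12ᶜ ∩ C1ᶜ) := by
    have L := KozmaNitzan2024_lemma3_ii_notConn w a₁ a₃ b ({a₂} : Set (Fin n)) hle13
    have hset : {ω : BondConfig (Fin n) | ∀ u ∈ ({a₂} : Set (Fin n)), ¬ (openGraph ω).Reachable a₁ u} = R12ᶜ := by
      ext ω
      simp only [mem_setOf_eq, mem_singleton_iff, forall_eq, mem_compl_iff, hR12, knThm2_mem_openConn]
    rw [hset] at L
    have e1 := split (C1 ∩ R12ᶜ) C3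
    have e3 := split (C3 ∩ R12ᶜ) C1
    have hc : C1 ∩ R12ᶜ ∩ C3 = C3 ∩ R12ᶜ ∩ C1 := by
      ext ω; simp only [mem_inter_iff, mem_compl_iff]; tauto
    rw [hc] at e1
    linarith
  -- set inclusions feeding the core inequality
  have hA : μ.real (C1 ∩ C3ᶜ ∩ C2) + μ.real (C2 ∩ C1ᶜ ∩ C3ᶜ) ≤ μ.real (C2 ∩ C3ᶜ) := by
    have hd : Disjoint (C1 ∩ C3ᶜ ∩ C2) (C2 ∩ C1ᶜ ∩ C3ᶜ) := disjoint_left.mpr fun ω h1 h2 => h2.1.2 h1.1.1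
    rw [← measureReal_union hd (hmeas _)]
    refine measureReal_mono ?_
    intro ω hω
    rcases hω with h | h
    · exact ⟨h.2, h.1.2⟩
    · exact ⟨h.1.1, h.2⟩
  have hB : μ.real (C1 ∩ C3ᶜ ∩ C2ᶜ) ≤ μ.real (C1 ∩ R12ᶜ ∩ C3ᶜ) := by
    refine measureReal_mono ?_
    intro ω hω
    refine ⟨⟨hω.1.1, fun h12r => hω.2 ?_⟩, hω.1.2⟩
    exact (show (openGraph ω).Reachable a₁ a₂ from h12r).symm.trans hω.1.1
  have hC : μ.real (C2 ∩ C1ᶜ ∩ C3) ≤ μ.real (C3 ∩ R12ᶜ ∩ C1ᶜ) := by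
    refine measureReal_mono ?_
    intro ω hω
    refine ⟨⟨hω.2, fun h12r => hω.1.2 ?_⟩, hω.1.2⟩
    exact (show (openGraph ω).Reachable a₁ a₂ from h12r).trans hω.1.1
  have hEeq : C3 ∩ C1ᶜ ∩ R12 = E := by
    rw [hE]; ext ω; simp only [mem_inter_iff, mem_compl_iff]; tauto
  have hX : C3 ∩ R12ᶜ ∩ C1ᶜ = C3 ∩ C1ᶜ ∩ R12ᶜ := by
    ext ω; simp only [mem_inter_iff, mem_compl_iff]; tauto
  rw [hX] at hrow13 hC
  have e13 := split (C1 ∩ C3ᶜ) C2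
  have e21 := split (C2 ∩ C1ᶜ) C3
  have e31 := split (C3 ∩ C1ᶜ) R12
  rw [hEeq] at e31
  -- assemble
  have core : μ.real (C1 ∩ C3ᶜ) + μ.real (C2 ∩ C1ᶜ) + 2 * μ.real E ≤ 2 * μ.real (C3 ∩ C1ᶜ) + μ.real (C3 ∩ C2ᶜ) := by
    linarith
  have f1 := split C1 C3
  have f3 := split C3 C1
  have g2 := split C2 C3
  have g3 := split C3 C2
  have hc13 : C1 ∩ C3 = C3 ∩ C1 := inter_comm _ _
  have hc23 : C2 ∩ C3 = C3 ∩ C2 := inter_comm _ _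
  rw [hc13] at f1
  rw [hc23] at g2
  rw [hs12, hs13, hs23]
  linarith
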